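import Literature.Barriers.RiemannHypothesis.DavenportHeilbronnSaiasWeingartnerProofs
import Literature.NumberTheory.LFunctions.HybridJointUniversalityProofs
import Literature.NumberTheory.LFunctions.SaiasWeingartnerProofs
import HarnessLib

/-!
# Discharge of the barrier-delimiting fact `SaiasWeingartner` (Saias–Weingartner 2009, Theorem 2)

Barrier catalogue `Literature/Barriers/RiemannHypothesis/` (D-0021), companion of
`DavenportHeilbronn.lean` and `DavenportHeilbronnSaiasWeingartnerProofs.lean`. The named fact
`Literature.Barriers.RiemannHypothesis.SaiasWeingartner` — Saias–Weingartner 2009, **Theorem 2**: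
for a finite set `C` of at least two primitive Dirichlet characters and non-zero Dirichlet
polynomials `P_ψ`, `F(s) = ∑_ψ P_ψ(s) L_ψ(s)` has `≫ T` distinct zeros in every strip
`σ₁ < Re s < σ₂`, `1/2 ≤ σ₁ < σ₂ ≤ 1 + η(F)`, `|Im s| ≤ T` — is PROVED here as `SaiasWeingartner_holds`,
by the bridge `SaiasWeingartner_of_pankowski` from

* the hybrid joint universality theorem on discs
  (`Literature.NumberTheory.LFunctions.Pankowski2010_thm1_1_discAnalytic_holds`,
  `HybridJointUniversalityProofs.lean`), which gives the case `σ₁ < 1` ("Theorem 2 of [KK07]",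
  `SaiasWeingartner2009_thm2_left_of_pankowski`), and
* the case `σ₁ ≥ 1` (`Literature.NumberTheory.LFunctions.SaiasWeingartner2009_thm2_right_holds`,
  `SaiasWeingartnerProofs.lean`; see also the tree's `SWLemma1.lean`, `SWLemma1Tools.lean`,
  `SWNonvanishing.lean`, `TwistedLSeries.lean`, `PrimeReciprocalAP.lean` for Lemmas 1–2 of the
  source via the Brouwer fixed point theorem and the prime number theorem for progressions).

## References

* [SaiasWeingartner2009] E. Saias, A. Weingartner, *Zeros of Dirichlet series with periodic
  coefficients*, Acta Arith. 140 (2009), 335–344, Theorem 2, §§3–4 (read, arXiv:0807.0783).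
* [Pankowski2010] Ł. Pańkowski, Acta Arith. 141 (2010), 59–72, Theorem 1.1, Cor. 5.3 (read).
-/

noncomputable section

namespace Literature.Barriers.RiemannHypothesis

open Literature.NumberTheory.LFunctions

/-- **Saias–Weingartner 2009, Theorem 2 — PROVED** (discharge of the named fact
`SaiasWeingartner`): "Let `C` be a finite set of at least two primitive Dirichlet characters, and
let `(P_ψ)_{ψ ∈ C}` be a family of non-zero Dirichlet polynomials. Define
`F(s) := ∑_{ψ ∈ C} P_ψ(s) L_ψ(s)`. Then there exists a number `η = η(F) > 0` such that, for all
real numbers `σ₁` and `σ₂` with `1/2 ≤ σ₁ < σ₂ ≤ 1 + η` and all sufficiently large `T`, we have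
`N'_F(σ₁, σ₂, T) ≫_{F,σ₁,σ₂} T`." [cite: SaiasWeingartner2009, Thm. 2] -/
theorem SaiasWeingartner_holds : SaiasWeingartner :=
  SaiasWeingartner_of_pankowski Pankowski2010_thm1_1_discAnalytic_holds
    SaiasWeingartner2009_thm2_right_holds

end Literature.Barriers.RiemannHypothesis
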